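import Literature.Topology.FourManifolds.ConnectedSumAmphichiralUniqueness
import Literature.Topology.FourManifolds.ConnectedSumSphereIdentity
import Literature.Topology.FourManifolds.PalaisBallComplement
import HarnessLib

/-!
# Transport of connected sums along diffeomorphisms of a summand onto a manifold with ANOTHER model

Topic `Literature/Topology/FourManifolds`.  The tree's relational connected sum
`IsConnectedSum IP IM IN M N P` (`ConnectedSum.lean`) allows the summands `M`, `N` to carry
arbitrary real models, and `ConnectedSumSphereIdentity.lean` transports it along diffeomorphisms
of a summand *with the same model* (`IsConnectedSum.of_diffeomorph_right/left`,
`ψ : N ≃ₘ⟮IN, IN⟯ N'`).  In the tree the summand `S² × S¹` of `IsSphereTwoProdCircleSum`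
(`KirbyCalculus.lean`) is Mathlib's product manifold with the product model `(𝓡 2).prod (𝓡 1)`
(model space `ℝ² × ℝ¹`), while the `3`-manifolds produced by handle / surgery constructions are
charted on `ℝ³` and compared with it through CROSS-model diffeomorphisms
`≃ₘ⟮𝓡 3, (𝓡 2).prod (𝓡 1)⟯` (e.g. `∂(S¹ × B³) ≅ S² × S¹`, `OneOneHandlebodyBoundary.lean`).  This
file supplies the missing cross-model transport, for boundaryless models on finite-dimensional
spaces of the same dimension:

* `Literature.Topology.FourManifolds.isSmoothEmbedding_diffeomorph_comp_disc` — a disc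
  `k : E → N` followed by a diffeomorphism `ψ : N ≃ₘ⟮IN, IN'⟯ N'` onto a manifold with another
  (boundaryless) model is a disc `ψ ∘ k : E → N'` (the disc is an open embedding by invariance of
  domain, `Manifold.IsSmoothEmbedding.isOpenMap_of_finrank_eq`; a globally defined partial
  diffeomorphism is a smooth embedding, `isSmoothEmbedding_of_openPartialHomeomorph`; Lee (2013),
  Prop. 5.2, Thm. 4.14).
* `Literature.Topology.FourManifolds.isSmoothEmbedding_comp_diffeomorph_of_isOpen_range` — an
  open smooth embedding `j : A → P` precomposed with a diffeomorphism `α : A' ≃ₘ⟮IA', IA⟯ A` from a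
  manifold with another (boundaryless) model is a smooth embedding (same mechanism).
* `Literature.Topology.FourManifolds.IsConnectedSum.of_diffeomorph_right'`,
  `Literature.Topology.FourManifolds.IsConnectedSum.of_diffeomorph_left'` — **being a connected
  sum is invariant under cross-model diffeomorphisms of the pieces**: if `P` is a connected sum
  `M # N` along `i₁`, `i₂` and `ψ : N ≃ₘ⟮IN, IN'⟯ N'`, then `P` is a connected sum `M # N'` along
  `i₁`, `ψ ∘ i₂` (Kervaire–Milnor (1963), §2, "well defined": the construction only sees `N`
  through the disc; Kosinski (1993), VI §1).  Hypotheses: the models of `N`, `N'`, `P` are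
  boundaryless, the disc space `EP` has the dimension of `N`, and `EP ≅ EN'` linearly.

Everything is proved; no definition and no named fact is introduced.

## References

* M. Kervaire, J. Milnor, *Groups of homotopy spheres I*, Ann. of Math. 77 (1963), §2.
  [KervaireMilnorAnnals1963]
* A. Kosinski, *Differential Manifolds* (1993), Ch. VI §1. [Kosinski1993]
* J. M. Lee, *Introduction to Smooth Manifolds*, 2nd ed. (2013), Prop. 5.2, Thm. 4.14.
  [LeeSmoothManifolds2013]
-/

open scoped Manifold ContDiff Topology
open Set Module Function Filter OpenPartialHomeomorph Metric

noncomputable section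

namespace Literature.Topology.FourManifolds

/-! ### Discs and open embeddings composed with cross-model diffeomorphisms -/

section Disc

variable {E : Type*} [NormedAddCommGroup E] [NormedSpace ℝ E] [FiniteDimensional ℝ E]
  {EN HN : Type*} [NormedAddCommGroup EN] [NormedSpace ℝ EN] [TopologicalSpace HN]
  {IN : ModelWithCorners ℝ EN HN}
  {EN' HN' : Type*} [NormedAddCommGroup EN'] [NormedSpace ℝ EN'] [TopologicalSpace HN']
  {IN' : ModelWithCorners ℝ EN' HN'}
  {N : Type*} [TopologicalSpace N] [ChartedSpace HN N] [IsManifold IN ∞ N]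
  {N' : Type*} [TopologicalSpace N'] [ChartedSpace HN' N'] [IsManifold IN' ∞ N']

omit [IsManifold IN ∞ N] in
/-- **A disc followed by a cross-model diffeomorphism is a disc.**  If `k : E → N` is a smooth
embedding of the finite-dimensional space `E` into the boundaryless manifold `N` (model `IN` over
`EN`, of the same dimension as `E`) and `ψ : N ≃ₘ⟮IN, IN'⟯ N'` is a diffeomorphism onto a manifold
with another boundaryless model `IN'` (over `EN' ≅ E`, `Λ`), then `ψ ∘ k : E → N'` is a smooth
embedding: `k` is an open embedding by invariance of domain
(`Manifold.IsSmoothEmbedding.isOpenMap_of_finrank_eq`), so `ψ ∘ k` is a globally defined partial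
diffeomorphism `E ⇀ N'` (inverse `k⁻¹ ∘ ψ⁻¹`, smooth by `contMDiffOn_symm_of_isSmoothEmbedding`),
hence a smooth embedding (`isSmoothEmbedding_of_openPartialHomeomorph`; Lee (2013), Prop. 5.2).
[folklore] -/
theorem isSmoothEmbedding_diffeomorph_comp_disc [IN.Boundaryless] [IN'.Boundaryless]
    [FiniteDimensional ℝ EN] {k : E → N} (hk : Manifold.IsSmoothEmbedding 𝓘(ℝ, E) IN ∞ k)
    (hdim : finrank ℝ E = finrank ℝ EN) (ψ : N ≃ₘ⟮IN, IN'⟯ N') (Λ : E ≃L[ℝ] EN') :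
    Manifold.IsSmoothEmbedding 𝓘(ℝ, E) IN' ∞ (ψ ∘ k) := by
  have hemb : Topology.IsOpenEmbedding k :=
    .of_continuous_injective_isOpenMap hk.contMDiff.continuous hk.isEmbedding.injective
      (Manifold.IsSmoothEmbedding.isOpenMap_of_finrank_eq hk hdim)
  set Φ₀ := hemb.toOpenPartialHomeomorph k with hΦ₀_def
  set Φ : OpenPartialHomeomorph E N' := Φ₀.trans ψ.toHomeomorph.toOpenPartialHomeomorph with hΦ
  have hΦcoe : ⇑Φ = ψ ∘ k := by
    ext u
    simp [hΦ, hΦ₀_def]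
  have hΦsrc : Φ.source = univ := by
    simp [hΦ, hΦ₀_def]
  have hΦc : ContMDiffOn 𝓘(ℝ, E) IN' ∞ Φ Φ.source := by
    rw [hΦcoe, hΦsrc]
    exact (ψ.contMDiff.comp hk.contMDiff).contMDiffOn
  have hΦsymm : ∀ x ∈ Φ.target, Φ.symm x = Φ₀.symm (ψ.symm x) := fun x _ => by
    simp [hΦ]
  have hΦt : ∀ x ∈ Φ.target, ψ.symm x ∈ range k := by
    intro x hx
    have h2 : Φ (Φ.symm x) = x := Φ.right_inv hx
    rw [hΦcoe, comp_apply] at h2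
    refine ⟨Φ.symm x, ?_⟩
    calc k (Φ.symm x) = ψ.symm (ψ (k (Φ.symm x))) := (ψ.symm_apply_apply _).symm
      _ = ψ.symm x := by rw [h2]
  have hΦc' : ContMDiffOn IN' 𝓘(ℝ, E) ∞ Φ.symm Φ.target := by
    have h1 : ContMDiffOn IN' 𝓘(ℝ, E) ∞ (Φ₀.symm ∘ ψ.symm) (ψ.symm ⁻¹' range k) :=
      (contMDiffOn_symm_of_isSmoothEmbedding hk hemb).comp ψ.symm.contMDiff.contMDiffOn
        fun x hx => hx
    exact (h1.mono fun x hx => hΦt x hx).congr hΦsymm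
  rw [← hΦcoe]
  exact isSmoothEmbedding_of_openPartialHomeomorph Φ hΦsrc hΦc hΦc' Λ

end Disc

section OpenEmbedding

variable {EA HA : Type*} [NormedAddCommGroup EA] [NormedSpace ℝ EA] [TopologicalSpace HA]
  {IA : ModelWithCorners ℝ EA HA}
  {EA' HA' : Type*} [NormedAddCommGroup EA'] [NormedSpace ℝ EA'] [TopologicalSpace HA']
  {IA' : ModelWithCorners ℝ EA' HA'}
  {EP HP : Type*} [NormedAddCommGroup EP] [NormedSpace ℝ EP] [TopologicalSpace HP]
  {IP : ModelWithCorners ℝ EP HP}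
  {A : Type*} [TopologicalSpace A] [ChartedSpace HA A] [IsManifold IA ∞ A]
  {A' : Type*} [TopologicalSpace A'] [ChartedSpace HA' A'] [IsManifold IA' ∞ A']
  {P : Type*} [TopologicalSpace P] [ChartedSpace HP P] [IsManifold IP ∞ P]

omit [IsManifold IA ∞ A] in
/-- **An open smooth embedding precomposed with a cross-model diffeomorphism is a smooth
embedding.**  If `j : A → P` is a smooth embedding with open range into the boundaryless manifold
`P` and `α : A' ≃ₘ⟮IA', IA⟯ A` is a diffeomorphism from a manifold with another boundaryless model
(over `EA' ≅ EP`, `Λ`), then `j ∘ α` is a smooth embedding: `j` is an open embedding, so `j ∘ α`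
is a globally defined partial diffeomorphism `A' ⇀ P` (Lee (2013), Prop. 5.2). [folklore] -/
theorem isSmoothEmbedding_comp_diffeomorph_of_isOpen_range [IA'.Boundaryless] [IP.Boundaryless]
    {j : A → P} (hj : Manifold.IsSmoothEmbedding IA IP ∞ j) (hjo : IsOpen (range j))
    (α : A' ≃ₘ⟮IA', IA⟯ A) (Λ : EA' ≃L[ℝ] EP) :
    Manifold.IsSmoothEmbedding IA' IP ∞ (j ∘ α) := by
  rcases isEmpty_or_nonempty A with hA | hA
  · haveI : IsEmpty A' := α.toEquiv.isEmpty
    exact ⟨Manifold.IsImmersionOfComplement.isImmersion (F := PUnit.{1}) fun x => isEmptyElim x,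
      Topology.IsEmbedding.of_subsingleton _⟩
  have hemb : Topology.IsOpenEmbedding j := ⟨hj.isEmbedding, hjo⟩
  set Φ₀ := hemb.toOpenPartialHomeomorph j with hΦ₀_def
  set Φ : OpenPartialHomeomorph A' P := α.toHomeomorph.toOpenPartialHomeomorph.trans Φ₀ with hΦ
  have hΦcoe : ⇑Φ = j ∘ α := by
    ext u
    simp [hΦ, hΦ₀_def]
  have hΦsrc : Φ.source = univ := by
    simp [hΦ, hΦ₀_def]
  have hΦc : ContMDiffOn IA' IP ∞ Φ Φ.source := by
    rw [hΦcoe, hΦsrc]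
    exact (hj.contMDiff.comp α.contMDiff).contMDiffOn
  have hΦsymm : ∀ x ∈ Φ.target, Φ.symm x = α.symm (Φ₀.symm x) := fun x _ => by
    simp [hΦ]
  have hΦt : Φ.target ⊆ range j := by
    intro x hx
    have h2 : Φ (Φ.symm x) = x := Φ.right_inv hx
    rw [hΦcoe] at h2
    exact ⟨_, h2⟩
  have hΦc' : ContMDiffOn IP IA' ∞ Φ.symm Φ.target := by
    have h1 : ContMDiffOn IP IA' ∞ ((α.symm : A → A') ∘ Φ₀.symm) (range j) :=
      α.symm.contMDiff.comp_contMDiffOn (contMDiffOn_symm_of_isSmoothEmbedding hj hemb)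
    exact (h1.mono hΦt).congr hΦsymm
  rw [← hΦcoe]
  exact isSmoothEmbedding_of_openPartialHomeomorph Φ hΦsrc hΦc hΦc' Λ

end OpenEmbedding

/-! ### Cross-model transport of `IsConnectedSum` in a summand -/

section PieceTransport

variable {EP HP : Type*} [NormedAddCommGroup EP] [NormedSpace ℝ EP] [TopologicalSpace HP]
  {IP : ModelWithCorners ℝ EP HP}
  {EM HM : Type*} [NormedAddCommGroup EM] [NormedSpace ℝ EM] [TopologicalSpace HM]
  {IM : ModelWithCorners ℝ EM HM}
  {EN HN : Type*} [NormedAddCommGroup EN] [NormedSpace ℝ EN] [TopologicalSpace HN]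
  {IN : ModelWithCorners ℝ EN HN}
  {EN' HN' : Type*} [NormedAddCommGroup EN'] [NormedSpace ℝ EN'] [TopologicalSpace HN']
  {IN' : ModelWithCorners ℝ EN' HN'}
  {M N N' P : Type*} [TopologicalSpace M] [T2Space M] [ChartedSpace HM M]
  [TopologicalSpace N] [T2Space N] [ChartedSpace HN N] [TopologicalSpace N'] [T2Space N']
  [ChartedSpace HN' N'] [TopologicalSpace P] [ChartedSpace HP P]

/-- **Being a connected sum is invariant under cross-model diffeomorphisms of the second piece**:
if `P` is a connected sum `M # N` along the discs `i₁`, `i₂` and `ψ : N ≃ₘ⟮IN, IN'⟯ N'` is a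
diffeomorphism onto a manifold with a possibly different (boundaryless) model, then `P` is a
connected sum `M # N'` along `i₁`, `ψ ∘ i₂`: the new disc is `ψ ∘ i₂`
(`isSmoothEmbedding_diffeomorph_comp_disc`), the punctured piece `N' ∖ {ψ (i₂ 0)}` embeds through
the restriction `N' ∖ {ψ (i₂ 0)} ≅ N ∖ {i₂ 0}` of `ψ⁻¹` (`opensCongr`) followed by the old embedding
(`isSmoothEmbedding_comp_diffeomorph_of_isOpen_range`), and Kervaire–Milnor's relation only sees
`i₂` through `ψ ∘ i₂` (Kervaire–Milnor (1963), §2, "well defined"; the same-model case is the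
tree's `IsConnectedSum.of_diffeomorph_right`).  Hypotheses: `IN`, `IN'`, `IP` boundaryless, the
disc space `EP` finite-dimensional of the dimension of `N`, and `Λ : EP ≃L EN'`.
[cite: KervaireMilnorAnnals1963, §2, Lemma 2.1 (p. 505)] -/
theorem IsConnectedSum.of_diffeomorph_right' [FiniteDimensional ℝ EP] [FiniteDimensional ℝ EN]
    [IN.Boundaryless] [IN'.Boundaryless] [IP.Boundaryless]
    [IsManifold IN ∞ N] [IsManifold IN' ∞ N'] [IsManifold IP ∞ P]
    (h : IsConnectedSum IP IM IN M N P) (ψ : N ≃ₘ⟮IN, IN'⟯ N')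
    (hdim : finrank ℝ EP = finrank ℝ EN) (Λ : EP ≃L[ℝ] EN') :
    IsConnectedSum IP IM IN' M N' P := by
  obtain ⟨i₁, i₂, h₁, h₂, jA, jB, hA, hAo, hB, hBo, hU, hR⟩ := h
  have hmem : ∀ b : N', b ∈ puncture (ψ ∘ i₂) ↔ ψ.symm b ∈ puncture i₂ := fun b => by
    rw [mem_puncture, mem_puncture, comp_apply]
    constructor
    · intro h h'
      exact h (by rw [← h', Diffeomorph.apply_symm_apply])
    · intro h h'
      exact h (by rw [h', Diffeomorph.symm_apply_apply])
  set β := opensCongr ψ.symm (puncture (ψ ∘ i₂)) (puncture i₂) hmem with hβ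
  have hβs : Function.Surjective (β : ↥(puncture (ψ ∘ i₂)) → ↥(puncture i₂)) := β.surjective
  refine ⟨i₁, ψ ∘ i₂, h₁, isSmoothEmbedding_diffeomorph_comp_disc h₂ hdim ψ Λ, jA, jB ∘ β, hA,
    hAo, isSmoothEmbedding_comp_diffeomorph_of_isOpen_range hB hBo β Λ.symm, ?_, ?_, fun a b => ?_⟩
  · rwa [hβs.range_comp]
  · rwa [hβs.range_comp]
  · rw [comp_apply, hR]
    constructor
    · rintro ⟨u, t, hu, ht, ha, hb⟩
      refine ⟨u, t, hu, ht, ha, ?_⟩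
      rw [hβ, coe_opensCongr_apply] at hb
      show (b : N') = ψ (i₂ ((1 - t) • u))
      rw [← hb, Diffeomorph.apply_symm_apply]
    · rintro ⟨u, t, hu, ht, ha, hb⟩
      refine ⟨u, t, hu, ht, ha, ?_⟩
      rw [hβ, coe_opensCongr_apply, hb]
      exact ψ.symm_apply_apply _

/-- Symmetrically, **cross-model transport in the first piece**: a connected sum `M # N` along
`i₁`, `i₂` is a connected sum `M' # N` along `φ ∘ i₁`, `i₂` for every diffeomorphism
`φ : M ≃ₘ⟮IM, IM'⟯ M'` onto a manifold with another boundaryless model (Kervaire–Milnor (1963),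
§2). [cite: KervaireMilnorAnnals1963, §2, Lemma 2.1 (p. 505)] -/
theorem IsConnectedSum.of_diffeomorph_left' {EM' HM' : Type*} [NormedAddCommGroup EM']
    [NormedSpace ℝ EM'] [TopologicalSpace HM'] {IM' : ModelWithCorners ℝ EM' HM'}
    {M' : Type*} [TopologicalSpace M'] [T2Space M'] [ChartedSpace HM' M']
    [FiniteDimensional ℝ EP] [FiniteDimensional ℝ EM]
    [IM.Boundaryless] [IM'.Boundaryless] [IP.Boundaryless]
    [IsManifold IM ∞ M] [IsManifold IM' ∞ M'] [IsManifold IP ∞ P]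
    (h : IsConnectedSum IP IM IN M N P) (φ : M ≃ₘ⟮IM, IM'⟯ M')
    (hdim : finrank ℝ EP = finrank ℝ EM) (Λ : EP ≃L[ℝ] EM') :
    IsConnectedSum IP IM' IN M' N P :=
  ((h.symm).of_diffeomorph_right' φ hdim Λ).symm

end PieceTransport

end Literature.Topology.FourManifolds

end
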